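import Summits.FinalStateConjecture.FinalStateConjecture.Theses.LateLocalKicks
import Literature.Geometry.Lorentzian.DataEmbeddingConstraints
import Literature.Geometry.Lorentzian.AdmissibleDataLocality

/-!
# Strategy-census workfile for the crux `LateLocalKicks.KickTransport` (stmt-FinalStateConjecture-11696)

Typed decomposition attempt D1 of the crux-strategist census (`STRATEGY-CENSUS.md` in this directory):
window core `KickTransportWindow` (X₁) ⊕ reparametrisation `LocalKickReparametrisation` (X₂), with

* `KickTransport_of_D1 : KickTransportWindow → LocalKickReparametrisation → KickTransport` — PROVED; the
  assembly DERIVES the "every member admissible" clause of the crux from the CoSlice developments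
  (`VacuumCauchyDevelopment.isVacuumConstraintSolution_data`, proved Literature) and agreement off a compact
  set (`InitialDataSet.mem_admissibleVacuumData_of_agree_off_compact`, proved Literature);
* `localKickReparametrisation_holds : LocalKickReparametrisation` — PROVED (bump reparametrisation
  `G″ c := G (χ(c) • c)`, `χ : ContDiffBump 0` with `rIn = δ/2`, `rOut = δ`);
* `KickTransport_of_window : KickTransportWindow → KickTransport` — PROVED corollary: the crux follows from
  its WINDOW CORE alone (joint smoothness only on `{|c₀| < δ}`, no admissibility clause, CoSlice on the
  window) — the recommended target for the eventual prover of the item (lift this file into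
  `Theorems/LateLocalKicksKickTransportWindow.lean` with `--supports stmt-FinalStateConjecture-11696`).

Because X₂ is proved, D1 has ONE open piece: it is a downward restatement of the crux, not a k ≥ 2 split —
see the census for why nothing is filed as route items. `lean check`: rc 0, 0 sorries; axioms of
`KickTransport_of_window`: propext, Classical.choice, Quot.sound.
-/

set_option linter.unusedVariables false
set_option linter.dupNamespace false

noncomputable section

namespace Summit.FinalStateConjecture.FinalStateConjecture.Cruxes.KickTransport.Census

open scoped Manifold ContDiff Topology
open Set Filter Bundle Literature.Geometry.Lorentzian

/-- Window form of joint smoothness: the two section maps of `F` are `C^∞` on `s ×ˢ univ ⊆ ℝ¹ × X`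
(the body of `InitialDataSet.IsSmoothDataFamily 1` with `ContMDiff` replaced by `ContMDiffOn`). -/
def IsSmoothDataFamilyOn {X : Type} [TopologicalSpace X] [ChartedSpace E3 X]
    [IsManifold (𝓡 3) ((⊤ : ℕ∞) : WithTop ℕ∞) X]
    (s : Set (EuclideanSpace ℝ (Fin 1))) (F : EuclideanSpace ℝ (Fin 1) → InitialDataSet (𝓡 3) X) :
    Prop :=
  ContMDiffOn (𝓘(ℝ, EuclideanSpace ℝ (Fin 1)).prod (𝓡 3)) ((𝓡 3).prod 𝓘(ℝ, E3 →L[ℝ] E3 →L[ℝ] ℝ)) ∞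
      (fun p : EuclideanSpace ℝ (Fin 1) × X ↦
        TotalSpace.mk' (F := E3 →L[ℝ] E3 →L[ℝ] ℝ)
          (E := fun x : X ↦ TangentSpace (𝓡 3) x →L[ℝ] TangentSpace (𝓡 3) x →L[ℝ] ℝ) p.2
          ((F p.1).h.inner p.2)) (s ×ˢ univ) ∧
    ContMDiffOn (𝓘(ℝ, EuclideanSpace ℝ (Fin 1)).prod (𝓡 3)) ((𝓡 3).prod 𝓘(ℝ, E3 →L[ℝ] E3 →L[ℝ] ℝ)) ∞
      (fun p : EuclideanSpace ℝ (Fin 1) × X ↦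
        TotalSpace.mk' (F := E3 →L[ℝ] E3 →L[ℝ] ℝ)
          (E := fun x : X ↦ TangentSpace (𝓡 3) x →L[ℝ] TangentSpace (𝓡 3) x →L[ℝ] ℝ) p.2
          ((F p.1).k p.2)) (s ×ˢ univ)

/-- **D1 piece X₁ — `KickTransportWindow`** (the PDE/geometric core: time-symmetric Cauchy stability
on the compact lens between the pinned co-slices + domain of dependence + re-slicing; Hawking–Ellis
1973 §7.6, Kato 1975): the crux with (i) joint smoothness asked only on the parameter window
`{|c₀| < δ}`, (ii) NO admissibility clause for the members `G c`, (iii) CoSlice on the window. -/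
def KickTransportWindow : Prop :=
  ∀ (X : Type) [TopologicalSpace X] [ChartedSpace E3 X] [IsManifold (𝓡 3) ((⊤ : ℕ∞) : WithTop ℕ∞) X] [T2Space X] [SecondCountableTopology X] [ConnectedSpace X], ∀ d ∈ admissibleVacuumData X, ∀ d' ∈ admissibleVacuumData X, let Local : InitialDataSet (𝓡 3) X → (EuclideanSpace ℝ (Fin 1) → InitialDataSet (𝓡 3) X) → Prop := fun D G ↦ InitialDataSet.IsSmoothDataFamily 1 G ∧ G 0 = D ∧ (∀ c, G c ∈ admissibleVacuumData X) ∧ ∃ K : Set X, IsCompact K ∧ ∀ c, ∀ x ∉ K, (G c).h.inner x = D.h.inner x ∧ (G c).k x = D.k x; let CoSlice : InitialDataSet (𝓡 3) X → InitialDataSet (𝓡 3) X → Prop := fun D D' ↦ ∃ (𝒟 : VacuumCauchyDevelopment D) (𝒟' : VacuumCauchyDevelopment D') (ψ : 𝒟'.carrier → 𝒟.carrier), ContMDiff (𝓡 4) (𝓡 4) ((⊤ : ℕ∞) : WithTop ℕ∞) ψ ∧ Topology.IsOpenEmbedding ψ ∧ 𝒟'.metric.IsIsometricImmersion 𝒟.metric.toPseudoRiemannianMetric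 ψ ∧ 𝒟'.timeOrientation.PreservesTimeOrientation ψ 𝒟.timeOrientation ∧ 𝒟.metric.IsCauchyHypersurface 𝒟.timeOrientation (Set.range (ψ ∘ 𝒟'.embed)) ∧ ∃ C : Set X, IsCompact C ∧ ∀ x ∉ C, ψ (𝒟'.embed x) = 𝒟.embed x; CoSlice d d' → ∀ G' : EuclideanSpace ℝ (Fin 1) → InitialDataSet (𝓡 3) X, Local d' G' → ∃ (δ : ℝ) (G : EuclideanSpace ℝ (Fin 1) → InitialDataSet (𝓡 3) X), 0 < δ ∧ G 0 = d ∧ (∃ K : Set X, IsCompact K ∧ ∀ c, ∀ x ∉ K, (G c).h.inner x = d.h.inner x ∧ (G c).k x = d.k x) ∧ IsSmoothDataFamilyOn {c | |c 0| < δ} G ∧ ∀ c : EuclideanSpace ℝ (Fin 1), |c 0| < δ → CoSlice (G c) (G' c)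

/-- **D1 piece X₂ — `LocalKickReparametrisation`** (differential topology, provable now: bump-function
reparametrisation `G̃ c := G (χ(c) • c)` with `χ ≡ 1` on `|c₀| ≤ δ/2`, `supp χ ⊆ {|c₀| < δ}`): a
window-local kick through an admissible `d` whose window members are admissible agrees near `0`
with a GLOBAL local kick (legend `Local`). -/
def LocalKickReparametrisation : Prop :=
  ∀ (X : Type) [TopologicalSpace X] [ChartedSpace E3 X] [IsManifold (𝓡 3) ((⊤ : ℕ∞) : WithTop ℕ∞) X] [T2Space X] [SecondCountableTopology X] [ConnectedSpace X], ∀ d ∈ admissibleVacuumData X, let Local : InitialDataSet (𝓡 3) X → (EuclideanSpace ℝ (Fin 1) → InitialDataSet (𝓡 3) X) → Prop := fun D G ↦ InitialDataSet.IsSmoothDataFamily 1 G ∧ G 0 = D ∧ (∀ c, G c ∈ admissibleVacuumData X) ∧ ∃ K : Set X, IsCompact K ∧ ∀ c, ∀ x ∉ K, (G c).h.inner x = D.h.inner x ∧ (G c).k x = D.k x; ∀ (δ : ℝ) (G : EuclideanSpace ℝ (Fin 1) → InitialDataSet (𝓡 3) X), 0 < δ → G 0 = d → (∃ K : Set X,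 IsCompact K ∧ ∀ c, ∀ x ∉ K, (G c).h.inner x = d.h.inner x ∧ (G c).k x = d.k x) → IsSmoothDataFamilyOn {c | |c 0| < δ} G → (∀ c : EuclideanSpace ℝ (Fin 1), |c 0| < δ → G c ∈ admissibleVacuumData X) → ∃ G'' : EuclideanSpace ℝ (Fin 1) → InitialDataSet (𝓡 3) X, Local d G'' ∧ ∀ c : EuclideanSpace ℝ (Fin 1), |c 0| < δ / 2 → G'' c = G c

/-- **Assembly of D1**: `KickTransportWindow → LocalKickReparametrisation → KickTransport`.
Content beyond composition: the admissibility of the window members `G c` is DERIVED — the CoSlice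
witness at `c` contains a vacuum Cauchy development of `G c`, whose data solve the vacuum
constraints (`VacuumCauchyDevelopment.isVacuumConstraintSolution_data`), and `G c = d` off the
compact `K` transfers the sole DR-flat end and completeness
(`InitialDataSet.mem_admissibleVacuumData_of_agree_off_compact`); then `δ/2`-bookkeeping. -/
theorem KickTransport_of_D1 (hW : KickTransportWindow) (hR : LocalKickReparametrisation) :
    Theses.LateLocalKicks.KickTransport := by
  intro X _ _ _ _ _ _ d hd d' hd' Local CoSlice hco G' hG'
  obtain ⟨δ, G, hδ, hG0, ⟨K, hK, hagree⟩, hsmooth, hco'⟩ := hW X d hd d' hd' hco G' hG'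
  -- admissibility of the window members, from the CoSlice developments + agreement off `K`
  have hadm : ∀ c : EuclideanSpace ℝ (Fin 1), |c 0| < δ → G c ∈ admissibleVacuumData X := by
    intro c hc
    obtain ⟨𝒟, -⟩ := hco' c hc
    exact InitialDataSet.mem_admissibleVacuumData_of_agree_off_compact hd
      (fun {_} ↦ 𝒟.isVacuumConstraintSolution_data) hK (hagree c)
  obtain ⟨G'', hloc, heq⟩ := hR X d hd δ G hδ hG0 ⟨K, hK, hagree⟩ hsmooth hadm
  refine ⟨G'', hloc, δ / 2, half_pos hδ, fun c hc ↦ ?_⟩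
  rw [heq c hc]
  exact hco' c (lt_of_lt_of_le hc (half_le_self hδ.le))


/-! ### `X₂` is provable now: the bump reparametrisation -/

/-- On `ℝ¹ = EuclideanSpace ℝ (Fin 1)` the norm is `|c 0|`. -/
theorem norm_euclideanOne (c : EuclideanSpace ℝ (Fin 1)) : ‖c‖ = |c 0| := by
  rw [EuclideanSpace.norm_eq, Fin.sum_univ_one, Real.norm_eq_abs, sq_abs, Real.sqrt_sq_eq_abs]

/-- **`LocalKickReparametrisation` holds** (bump reparametrisation `G″ c := G (χ(c) • c)` with `χ` a
smooth bump, `χ = 1` on `‖c‖ ≤ δ/2`, `χ = 0` off `‖c‖ < δ`): joint smoothness on the window composes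
with the smooth map `(c, x) ↦ (χ(c) • c, x)` into the window (`ContMDiffOn.comp_contMDiff`), the
remaining clauses are inherited member-wise. [folklore] -/
theorem localKickReparametrisation_holds : LocalKickReparametrisation := by
  intro X _ _ _ _ _ _ d hd Local δ G hδ hG0 hK hsmooth hadm
  obtain ⟨K, hKc, hagree⟩ := hK
  -- the bump and the reparametrisation map
  let χ : ContDiffBump (0 : EuclideanSpace ℝ (Fin 1)) := ⟨δ / 2, δ, half_pos hδ, half_lt_self hδ⟩
  let φ : EuclideanSpace ℝ (Fin 1) → EuclideanSpace ℝ (Fin 1) := fun c ↦ (χ c) • c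
  have hφs : ContDiff ℝ ∞ φ := χ.contDiff.smul contDiff_id
  have hφ0 : ∀ c : EuclideanSpace ℝ (Fin 1), φ c 0 = χ c * c 0 := fun c ↦ by
    simp [φ, smul_eq_mul]
  have hφwin : ∀ c : EuclideanSpace ℝ (Fin 1), |φ c 0| < δ := by
    intro c
    rw [hφ0, abs_mul, abs_of_nonneg (χ.nonneg)]
    by_cases hc : δ ≤ ‖c‖
    · have h0 : χ c = 0 := χ.zero_of_le_dist (by simpa [dist_zero_right] using hc)
      rw [h0, zero_mul]
      exact hδ
    · push Not at hc
      rw [norm_euclideanOne] at hc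
      calc χ c * |c 0| ≤ 1 * |c 0| := by gcongr; exact χ.le_one
        _ = |c 0| := one_mul _
        _ < δ := hc
  have hφid : ∀ c : EuclideanSpace ℝ (Fin 1), |c 0| < δ / 2 → φ c = c := by
    intro c hc
    have h1 : χ c = 1 := χ.one_of_mem_closedBall (by
      rw [Metric.mem_closedBall, dist_zero_right, norm_euclideanOne]
      exact hc.le)
    simp [φ, h1]
  have hφzero : φ 0 = 0 := by simp [φ]
  -- joint smoothness: compose the window smoothness with `(c, x) ↦ (φ c, x)`
  have hsm : ContMDiff (𝓘(ℝ, EuclideanSpace ℝ (Fin 1)).prod (𝓡 3))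
      (𝓘(ℝ, EuclideanSpace ℝ (Fin 1)).prod (𝓡 3)) ∞
      (fun p : EuclideanSpace ℝ (Fin 1) × X ↦ (φ p.1, p.2)) :=
    (hφs.contMDiff.comp contMDiff_fst).prodMk contMDiff_snd
  have hmaps : ∀ p : EuclideanSpace ℝ (Fin 1) × X,
      (φ p.1, p.2) ∈ ({c : EuclideanSpace ℝ (Fin 1) | |c 0| < δ}) ×ˢ (univ : Set X) :=
    fun p ↦ ⟨hφwin p.1, trivial⟩
  refine ⟨fun c ↦ G (φ c), ⟨⟨hsmooth.1.comp_contMDiff hsm hmaps, hsmooth.2.comp_contMDiff hsm hmaps⟩,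
    ?_, fun c ↦ hadm (φ c) (hφwin c), K, hKc, fun c ↦ hagree (φ c)⟩, fun c hc ↦ ?_⟩
  · show G (φ 0) = d
    rw [hφzero, hG0]
  · show G (φ c) = G c
    rw [hφid c hc]

/-- Hence the crux follows from the window core ALONE plus proved lemmas:
`KickTransportWindow → KickTransport`. -/
theorem KickTransport_of_window (hW : KickTransportWindow) : Theses.LateLocalKicks.KickTransport :=
  KickTransport_of_D1 hW localKickReparametrisation_holds

end Summit.FinalStateConjecture.FinalStateConjecture.Cruxes.KickTransport.Census

end
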